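import Mathlib.RingTheory.RootsOfUnity.Complex
import Summits.Schanuel.Schanuel.Theorems.ZilberEacComplexCyclicCoverRoot
import HarnessLib

/-!
# EC over ALL cyclic covers `xₙ^e = P(x')` of order `e ≥ 3` (no direction hypothesis left)

The root form of the cyclic-cover theorem (`exists_expPoint_cyclicCoverBM_avoiding_of_root`,
`ZilberEacComplexCyclicCoverRoot.lean`) produces exponential points of
`V = {xₙ^e = P(x'), (x', (yⱼ - yₙ Fⱼ(yₙ, xₙ, x'))ⱼ) ∈ W}` as soon as SOME `e`-th root `τ` of SOME
non-zero lattice value `P_D(2πi q₀)` has `Re τ < 0`. For `e ≥ 3` this residual hypothesis is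
automatic:

* `P_D ≠ 0` does not vanish on the Zariski-dense lattice `(2πiℤ)ˢ`
  (`Literature.NumberTheory.Transcendental.ExpDominant.exists_int_eval_ne_zero`), and
* the `e` roots of a non-zero number are the vertices of a regular `e`-gon centred at `0`; their
  sum vanishes, so they cannot all lie in the closed right half-plane unless they are all purely
  imaginary, which forces `sin(2π/e) = 0`, impossible for `e ≥ 3` (`exists_pow_eq_of_re_neg`).

Hence **EC holds for every cyclic cover `xₙ^e = P(x₁..xₛ)` with `e ≥ 3`, `deg P ≥ 1`, and every
Brownawell–Masser puncture fibre** (`exists_expPoint_cyclicCoverBM_of_three_le`, EC vocabulary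
`cyclicCoverBM_inter_expGraph_nonempty_of_three_le`); only the double covers `e = 2` with
`P_D(2πiℤˢ) ⊆ ℝ_{≤ 0}` (the oscillatory/imaginary-root regime of `ZilberEacComplexQuadricCover.lean`)
and the graphs `e = 1` keep a direction hypothesis. First open rung of EAC (`dim π₁ V = n - 1`):
Mantova–Masser, PLMS 129 (2024), §1 p. 5. (Corollary suggested by the cross-referee, REFEREE S1-R36.)

HONEST FRAMING: a modest new sub-rung of Exponential-Algebraic Closedness; nothing here bears on
Schanuel's conjecture, and EAC does not imply it.
-/

noncomputable section

open Complex MvPolynomial Metric Set Filter Topology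
open Literature.NumberTheory.Transcendental

set_option linter.dupNamespace false

namespace Summit.Schanuel.Schanuel.Theorems

/-- **Some `e`-th root lies in the open left half-plane (`e ≥ 3`).** For `c ≠ 0` and `e ≥ 3` there
is `τ` with `τ^e = c` and `Re τ < 0`: the roots `ρ ζʲ` (`ρ = c^{1/e}`, `ζ = e^{2πi/e}`) sum to `0`
(`Σⱼ ζʲ = 0`), so if all had `Re ≥ 0` then `Re ρ = Re ρζ = 0`, whence `Im ζ = sin(2π/e) = 0`,
absurd. [folklore] -/
theorem exists_pow_eq_of_re_neg {e : ℕ} (he : 3 ≤ e) {c : ℂ} (hc : c ≠ 0) :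
    ∃ τ : ℂ, τ ^ e = c ∧ τ.re < 0 := by
  have he0 : e ≠ 0 := by omega
  set ρ : ℂ := c ^ ((e : ℂ)⁻¹) with hρ
  have hρe : ρ ^ e = c := Complex.cpow_nat_inv_pow c he0
  have hρ0 : ρ ≠ 0 := by
    intro h0; rw [h0, zero_pow he0] at hρe; exact hc hρe.symm
  set ζ : ℂ := exp (2 * Real.pi * I / e) with hζ
  have hprim : IsPrimitiveRoot ζ e := Complex.isPrimitiveRoot_exp e he0
  have hζe : ζ ^ e = 1 := hprim.pow_eq_one
  -- every `ρ ζʲ` is an `e`-th root of `c`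
  have hroot : ∀ j : ℕ, (ρ * ζ ^ j) ^ e = c := by
    intro j
    rw [mul_pow, ← pow_mul, mul_comm j e, pow_mul, hζe, one_pow, mul_one, hρe]
  by_cases hex : ∃ j ∈ Finset.range e, (ρ * ζ ^ j).re < 0
  · obtain ⟨j, -, hj⟩ := hex
    exact ⟨ρ * ζ ^ j, hroot j, hj⟩
  · exfalso
    have hnonneg : ∀ j ∈ Finset.range e, 0 ≤ (ρ * ζ ^ j).re := fun j hj =>
      not_lt.mp fun h => hex ⟨j, hj, h⟩
    -- the roots sum to zero
    have hsum : ∑ j ∈ Finset.range e, ρ * ζ ^ j = 0 := by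
      rw [← Finset.mul_sum, hprim.geom_sum_eq_zero (by omega), mul_zero]
    have hsumre : ∑ j ∈ Finset.range e, (ρ * ζ ^ j).re = 0 := by
      rw [← Complex.re_sum, hsum, Complex.zero_re]
    have hall := (Finset.sum_eq_zero_iff_of_nonneg hnonneg).mp hsumre
    have h0 : ρ.re = 0 := by simpa using hall 0 (Finset.mem_range.mpr (by omega))
    have h1 : (ρ * ζ ^ 1).re = 0 := hall 1 (Finset.mem_range.mpr (by omega))
    rw [pow_one, Complex.mul_re, h0, zero_mul, zero_sub, neg_eq_zero, mul_eq_zero] at h1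
    have hρim : ρ.im ≠ 0 := by
      intro him
      exact hρ0 (Complex.ext (by simp [h0]) (by simp [him]))
    have hζim : ζ.im = Real.sin (2 * Real.pi / e) := by
      rw [hζ, show (2 * Real.pi * I / e : ℂ) = ((2 * Real.pi / e : ℝ) : ℂ) * I by push_cast; ring,
        Complex.exp_ofReal_mul_I_im]
    have hsin : 0 < Real.sin (2 * Real.pi / e) := by
      have he3 : (3 : ℝ) ≤ e := by exact_mod_cast he
      refine Real.sin_pos_of_pos_of_lt_pi (by positivity) ?_
      rw [div_lt_iff₀ (by positivity)]
      nlinarith [Real.pi_pos]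
    rcases h1 with h | h
    · exact hρim h
    · rw [hζim] at h; exact hsin.ne' h

/-- **EC over every cyclic cover of order `e ≥ 3` with Brownawell–Masser puncture fibre.** Let
`e ≥ 3`, `P ∈ ℂ[x₁..xₛ]` with `deg P ≥ 1`, `W ⊆ ℂˢ × ℂˢ` irreducible with `dim W = s` and dominant
additive projection of its torus part, `Fⱼ ∈ ℂ[u, w, x']` arbitrary and `h ≠ 0`. Then there are
`x' ∈ ℂˢ`, `xₙ ∈ ℂ` with `h(x') ≠ 0`, `xₙ^e = P(x')` and `(x', (e^{xⱼ} - e^{xₙ}Fⱼ(e^{xₙ}, xₙ, x'))ⱼ) ∈ W`: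
an exponential point (Zariski dense as `h` varies) of the `(s+1)`-fold
`V = {xₙ^e = P(x'), (x', (yⱼ - yₙFⱼ)ⱼ) ∈ W}`, additive projection the cyclic cover `xₙ^e = P(x')`,
`dim π₁ V = n - 1` — first open range of Exponential-Algebraic Closedness (Mantova–Masser 2024,
§1 p. 5). NO hypothesis on lattice directions remains: `P_D(2πi q₀) ≠ 0` for some `q₀ ∈ ℤˢ`
(density of the lattice) and some `e`-th root of it has negative real part (`e ≥ 3`), which is all
the root form of the cyclic-cover theorem needs. New. [cite: MantovaMasser2023, §1 p.5 (the open
case dim π(V) = 2 in ℂ³×ℂˣ³)] -/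
theorem exists_expPoint_cyclicCoverBM_of_three_le {s : ℕ} {e : ℕ} (he : 3 ≤ e)
    (P : MvPolynomial (Fin s) ℂ) (hD : 0 < P.totalDegree)
    (W : Set (Fin s ⊕ Fin s → ℂ)) (hW : IsIrreducibleClosed ℂ W) (hdim : zariskiDim ℂ W = s)
    (hdom : HasDominantAddProjection ℂ (W ∩ torusLocus ℂ s))
    (F : Fin s → MvPolynomial (Fin (s + 2)) ℂ) (h : MvPolynomial (Fin s) ℂ) (hh : h ≠ 0) :
    ∃ x : Fin s → ℂ, ∃ xn : ℂ, eval x h ≠ 0 ∧ xn ^ e = eval x P ∧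
      (Sum.elim x (fun j => exp (x j) - exp xn *
        eval (Fin.cons (exp xn) (Fin.cons xn x : Fin (s + 1) → ℂ)) (F j)) : Fin s ⊕ Fin s → ℂ) ∈ W := by
  have hP0 : P ≠ 0 := by
    intro h0; rw [h0, totalDegree_zero] at hD; exact lt_irrefl _ hD
  have hPD : homogeneousComponent P.totalDegree P ≠ 0 :=
    Literature.NumberTheory.Transcendental.ExpDominant.homogeneousComponent_totalDegree_ne_zero hP0
  obtain ⟨q₀, hq₀⟩ :=
    Literature.NumberTheory.Transcendental.ExpDominant.exists_int_eval_ne_zero _ hPD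
  obtain ⟨τ, hτ, hre⟩ := exists_pow_eq_of_re_neg he hq₀
  exact exists_expPoint_cyclicCoverBM_avoiding_of_root (by omega) P hD q₀ τ hτ hre W hW hdim hdom
    F h hh

/-- **The cyclic-cover varieties of order `e ≥ 3` meet the graph of exponentiation** (EC
vocabulary, no direction hypothesis). With `n = s + 1`, `e ≥ 3`, `deg P ≥ 1` and `W`
Brownawell–Masser, the subvariety `V = {xₙ^e = P(x₁..xₛ), (x', (yⱼ - yₙ Fⱼ(yₙ, xₙ, x'))ⱼ) ∈ W}` of
`ℂⁿ × ℂⁿ` contains a point of `Literature.NumberTheory.Transcendental.expGraph ℂ n`.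
[cite: MantovaMasser2023, §1 p.5 (the open case dim π(V) = 2 in ℂ³×ℂˣ³)] -/
theorem cyclicCoverBM_inter_expGraph_nonempty_of_three_le {s : ℕ} {e : ℕ} (he : 3 ≤ e)
    (P : MvPolynomial (Fin s) ℂ) (hD : 0 < P.totalDegree)
    (W : Set (Fin s ⊕ Fin s → ℂ)) (hW : IsIrreducibleClosed ℂ W) (hdim : zariskiDim ℂ W = s)
    (hdom : HasDominantAddProjection ℂ (W ∩ torusLocus ℂ s))
    (F : Fin s → MvPolynomial (Fin (s + 2)) ℂ) :
    ({z : Fin (s + 1) ⊕ Fin (s + 1) → ℂ |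
        z (Sum.inl (Fin.last s)) ^ e = eval (fun j => z (Sum.inl (Fin.castSucc j))) P ∧
        (Sum.elim (fun j => z (Sum.inl (Fin.castSucc j)))
            (fun j => z (Sum.inr (Fin.castSucc j)) - z (Sum.inr (Fin.last s)) *
              eval (Fin.cons (z (Sum.inr (Fin.last s)))
                (Fin.cons (z (Sum.inl (Fin.last s))) (fun i => z (Sum.inl (Fin.castSucc i))) :
                  Fin (s + 1) → ℂ)) (F j)) : Fin s ⊕ Fin s → ℂ) ∈ W} ∩
      Literature.NumberTheory.Transcendental.expGraph ℂ (s + 1)).Nonempty := by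
  obtain ⟨x, xn, -, hxn, hx⟩ := exists_expPoint_cyclicCoverBM_of_three_le he P hD W hW hdim hdom
    F 1 one_ne_zero
  set X : Fin (s + 1) → ℂ := Fin.snoc x xn with hX
  refine ⟨Sum.elim X fun i => exp (X i), ⟨?_, ?_⟩, fun i => ?_⟩
  · simp only [Sum.elim_inl, hX, Fin.snoc_last, Fin.snoc_castSucc]
    exact hxn
  · simp only [Sum.elim_inl, Sum.elim_inr, hX, Fin.snoc_castSucc, Fin.snoc_last]
    exact hx
  · simp [Literature.ModelTheory.ExponentialFields.ExponentialRing.complex_exp_eq]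

end Summit.Schanuel.Schanuel.Theorems
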